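import Summits.AtomisticToContinuum.FouriersLaw.Theorems.PuiseuxTransferLedgerContactIdentity
import Summits.AtomisticToContinuum.FouriersLaw.Theorems.PuiseuxTransferLedgerSeriesLedgerGlue
import Summits.AtomisticToContinuum.FouriersLaw.Theorems.PuiseuxTransferLedgerFiniteResponseProfile
import Summits.AtomisticToContinuum.FouriersLaw.Theorems.PuiseuxTransferLedgerExponentiallyAffineResistanceReductions
import Literature.Barriers.AtomisticToContinuum.FixedLengthNoConductivityControl

/-!
# PuiseuxTransferLedger — summit placement of the rank-2 crux `TwoModeBulk`
(item stmt-AtomisticToContinuum-12111; strategist r1, `--supports`)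

Sorry-free bookkeeping theorems that PLACE the crux `TwoModeBulk` relative to the sub-problem
Statement `_root_.FouriersLaw` and to the catalogued barrier predicate
`Literature.Barriers.AtomisticToContinuum.HasBoundedResponse` (entry
`FixedLengthNoConductivityControl`), for the tribunal of the BLOCKED route:

* `fouriersLaw_of_twoModeBulk_of_nonBallistic` — the route's proved `closes` with its six proved
  support items discharged: `TwoModeBulk → NonBallistic → FouriersLaw`.
* `nonBallistic_of_fouriersLaw` — the rank-3 crux is a CONSEQUENCE of the Statement
  (via `hasBoundedResponse_of_fouriersLawFor`).
* `fouriersLaw_iff_nonBallistic_of_twoModeBulk`,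
  `fouriersLaw_iff_forall_hasBoundedResponse_of_twoModeBulk` — CONDITIONAL ON THE CRUX the summit
  collapses to the barrier predicate: `TwoModeBulk → (FouriersLaw ↔ NonBallistic)` and
  `TwoModeBulk → (FouriersLaw ↔ ∀ admissible parameters, HasBoundedResponse (pinnedChain …))`.
* `boundedLedger_of_twoModeBulk` — the crux alone gives, along every steady-state family and for
  every `T > 0`, the `N`-uniform series ledger `|(N-1)/D_N - 2/γ - (N-1)·r| ≤ B` (`N ≥ 2`).
* `transportDichotomy_of_twoModeBulk` — hence at every parameter point either Fourier's law WITH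
  AN `O(1)` TOTAL-CONTACT-RESISTANCE RATE (`|(N-1)/D_N - (N-1)/κ| ≤ B`, `κ > 0`) or BALLISTIC
  transport (`D_N ≥ c·(N-1)`, `c > 0`): the crux decides the transport type of every pinned
  anharmonic chain up to one bit, with a rate.
* `rateFourier_of_twoModeBulk_of_fouriersLaw` — under the crux the Statement self-improves to the
  rate form (the ballistic branch contradicts `HasBoundedResponse`).

Reading (strategist census r1, `Cruxes/TwoModeBulk/STRATEGY-CENSUS.md`): the crux is not implied by
the Statement (it over-asks: exponential layers, exponential bulk rate, an `O(1/N)` rate for `D_N`)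
and does not imply it (the `r = 0` branch is the ballistic one, realised by the harmonic member,
support `HarmonicTwoModeCalibration`); conditional on it, what is left of the summit is exactly the
barrier predicate `HasBoundedResponse`, and every one of its consequences listed here is an
`N`-UNIFORM transport statement for a deterministic anharmonic chain — the class for which the
catalogue records no technique (`FixedLengthNoConductivityControl`, status: established).
-/

namespace Summit.AtomisticToContinuum.FouriersLaw.Theorems

namespace TwoModeBulkPlacement

open MeasureTheory Filter Topology
open Summit.AtomisticToContinuum.FouriersLaw.Theses.PuiseuxTransferLedger
open Literature.MathematicalPhysics.KineticTheory.HeatConduction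
open Literature.Barriers.AtomisticToContinuum

/-- **The two open cruxes decide the Statement** — the route's proved deciding theorem `closes`
with its six support hypotheses discharged by the proved items (`NessUnique_holds`,
`FiniteResponseOfUnique_holds`, `PositiveConductance_holds`, `finiteResponseProfile_proof`,
`contactIdentity_proof`, `seriesLedgerGlue_proof`). [folklore] -/
theorem fouriersLaw_of_twoModeBulk_of_nonBallistic (hTM : TwoModeBulk) (hNB : NonBallistic) :
    _root_.FouriersLaw :=
  Summit.AtomisticToContinuum.FouriersLaw.Theses.PuiseuxTransferLedger.closes NessUnique_holds
    FiniteResponseOfUnique_holds PositiveConductance_holds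
    PuiseuxTransferLedgerFiniteResponseProfile.finiteResponseProfile_proof contactIdentity_proof
    seriesLedgerGlue_proof hTM hNB

/-- A sequence with bounded absolute values is eventually below every line of positive slope
through `N = 1`: the non-ballistic clause for one response sequence. [folklore] -/
theorem subballistic_of_bddAbove {D : ℕ → ℝ} (hB : BddAbove (Set.range fun N => |D N|))
    {ε : ℝ} (hε : 0 < ε) (N₀ : ℕ) : ∃ N : ℕ, N₀ ≤ N ∧ D N ≤ ε * ((N : ℝ) - 1) := by
  obtain ⟨B, hB⟩ := hB
  have h2 : ∀ᶠ N : ℕ in atTop, B ≤ ε * ((N : ℝ) - 1) :=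
    (tendsto_natCast_sub_one_atTop.const_mul_atTop hε).eventually_ge_atTop B
  obtain ⟨N, hN, hN₀⟩ := (h2.and (eventually_ge_atTop N₀)).exists
  exact ⟨N, hN₀, ((le_abs_self _).trans (hB ⟨N, rfl⟩)).trans hN⟩

/-- The barrier predicate at every admissible parameter point implies the rank-3 crux
`NonBallistic` (the weak-uniqueness hypothesis of the crux is not used). [folklore] -/
theorem nonBallistic_of_forall_hasBoundedResponse'
    (h : ∀ ω₂ lam β γ : ℝ, 0 < ω₂ → 0 < lam → 0 < β → 0 < γ →
      HasBoundedResponse (pinnedChain ω₂ lam β γ)) :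
    NonBallistic := by
  intro ω₂ lam β γ hω hl hβ hγ _huniq μ hμ T hT D hD ε hε N₀
  exact subballistic_of_bddAbove (h ω₂ lam β γ hω hl hβ hγ μ hμ T hT D hD) hε N₀

/-- **The rank-3 crux is a consequence of the Statement**: `FouriersLaw → NonBallistic`, through
the catalogued necessary condition `hasBoundedResponse_of_fouriersLawFor` (BLR 2000 §6.3: the
finite-size conductivity of a chain obeying Fourier's law is bounded in `N`).
[cite: BonettoLebowitzReyBellet2000, §6.3 (arXiv p. 12)] -/
theorem nonBallistic_of_fouriersLaw (h : _root_.FouriersLaw) : NonBallistic :=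
  nonBallistic_of_forall_hasBoundedResponse' fun ω₂ lam β γ hω hl hβ hγ =>
    hasBoundedResponse_of_fouriersLawFor (h ω₂ lam β γ hω hl hβ hγ)

/-- **Placement, form 1.** Conditional on the rank-2 crux `TwoModeBulk`, the sub-problem Statement
is EQUIVALENT to the route's other open crux `NonBallistic`. [folklore] -/
theorem fouriersLaw_iff_nonBallistic_of_twoModeBulk (hTM : TwoModeBulk) :
    _root_.FouriersLaw ↔ NonBallistic :=
  ⟨nonBallistic_of_fouriersLaw, fouriersLaw_of_twoModeBulk_of_nonBallistic hTM⟩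

/-- **Placement, form 2.** Conditional on `TwoModeBulk`, the sub-problem Statement is EQUIVALENT to
the catalogued barrier predicate `HasBoundedResponse (pinnedChain ω₂ lam β γ)` at every admissible
parameter point (`Literature/Barriers/AtomisticToContinuum/FixedLengthNoConductivityControl.lean`,
"blocks: `HasBoundedResponse (pinnedChain …)`"): what the crux leaves of the summit is exactly the
`N`-uniform boundedness of the finite-size conductivity. [cite: BonettoLebowitzReyBellet2000, §6.3 (arXiv p. 12)] -/
theorem fouriersLaw_iff_forall_hasBoundedResponse_of_twoModeBulk (hTM : TwoModeBulk) :
    _root_.FouriersLaw ↔ ∀ ω₂ lam β γ : ℝ, 0 < ω₂ → 0 < lam → 0 < β → 0 < γ →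
      HasBoundedResponse (pinnedChain ω₂ lam β γ) :=
  ⟨fun h ω₂ lam β γ hω hl hβ hγ => hasBoundedResponse_of_fouriersLawFor (h ω₂ lam β γ hω hl hβ hγ),
    fun h => fouriersLaw_of_twoModeBulk_of_nonBallistic hTM
      (nonBallistic_of_forall_hasBoundedResponse' h)⟩

/-- **The `N`-uniform series ledger from the crux alone.** For `pinnedChain ω₂ lam β γ` (all `> 0`)
with unique weak steady states, along ANY steady-state family, for every `T > 0` and every sequence
`D` of response coefficients, `TwoModeBulk` gives `r, B ∈ ℝ` with
`|(N-1)/D_N - 2/γ - (N-1)·r| ≤ B` for all `N ≥ 2` (`B = 2 max(C,0)/(1-θ)`): the contact rows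
(`contactIdentity_proof`), positivity `D_N > 0` (`PositiveConductance_holds`) and the profile
limits (`finiteResponseProfile_proof`) are proved items; the estimate is the telescoping-plus-
geometric-sum step of the route's `closes`, isolated. [folklore] -/
theorem boundedLedger_of_twoModeBulk (hTM : TwoModeBulk) {ω₂ lam β γ : ℝ} (hω : 0 < ω₂)
    (hl : 0 < lam) (hβ : 0 < β) (hγ : 0 < γ)
    (huniq : ∀ (N : ℕ) (T_L T_R : ℝ), 0 < T_L → 0 < T_R → ∀ μ ν : Measure (PhaseSpace N),
      (pinnedChain ω₂ lam β γ).IsSteadyState N T_L T_R μ →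
        (pinnedChain ω₂ lam β γ).IsSteadyState N T_L T_R ν → μ = ν)
    (μ : (N : ℕ) → ℝ → ℝ → Measure (PhaseSpace N))
    (hμ : ∀ (N : ℕ) (T_L T_R : ℝ), 0 < T_L → 0 < T_R →
      (pinnedChain ω₂ lam β γ).IsSteadyState N T_L T_R (μ N T_L T_R))
    {T : ℝ} (hT : 0 < T) (D : ℕ → ℝ)
    (hD : ∀ N : ℕ, Tendsto
      (fun δ : ℝ => (pinnedChain ω₂ lam β γ).totalCurrent (μ N (T + δ / 2) (T - δ / 2)) / δ)
      (𝓝[≠] 0) (𝓝 (D N))) :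
    ∃ r B : ℝ, ∀ N : ℕ, 2 ≤ N → |((N : ℝ) - 1) / D N - 2 / γ - ((N : ℝ) - 1) * r| ≤ B := by
  classical
  have ht' := PuiseuxTransferLedgerFiniteResponseProfile.finiteResponseProfile_proof ω₂ lam β γ
    hω hl hβ hγ huniq μ hμ T hT
  choose t ht using ht'
  have hpos : ∀ N : ℕ, 2 ≤ N → 0 < D N :=
    PositiveConductance_holds ω₂ lam β γ hω hl hβ hγ huniq μ hμ T hT D hD
  obtain ⟨r, θ, C, hθ0, hθ1, hbulk⟩ := hTM ω₂ lam β γ hω hl hβ hγ huniq μ hμ T hT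
  have h1θ : 0 < 1 - θ := sub_pos.mpr hθ1
  refine ⟨r, 2 * max C 0 / (1 - θ), ?_⟩
  intro N hN
  have hN2 : (2 : ℝ) ≤ (N : ℝ) := by exact_mod_cast hN
  have hNpos : (0 : ℝ) < (N : ℝ) - 1 := by linarith
  have hN0 : (N : ℝ) - 1 ≠ 0 := ne_of_gt hNpos
  have hDpos : 0 < D N := hpos N hN
  have hD0 : D N ≠ 0 := ne_of_gt hDpos
  have hγ0 : γ ≠ 0 := ne_of_gt hγ
  have hg : 0 < D N / ((N : ℝ) - 1) := div_pos hDpos hNpos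
  -- the two bath sites
  have hlt0 : 0 < N := by omega
  have hltL : N - 1 < N := by omega
  obtain ⟨hc0, hcL⟩ := contactIdentity_proof ω₂ lam β γ hω hl hβ hγ huniq μ hμ T hT N (D N)
    (t N ⟨0, hlt0⟩) (t N ⟨N - 1, hltL⟩) ⟨0, hlt0⟩ ⟨N - 1, hltL⟩ hN rfl rfl (hD N)
    (ht N ⟨0, hlt0⟩) (ht N ⟨N - 1, hltL⟩)
  have hbN := hbulk N (D N) (t N) (hD N) (fun i => ht N i)
  -- telescoping sequence over the sites 0, …, N-1
  let s : ℕ → ℝ := fun k => if hk : k < N then t N ⟨k, hk⟩ else 0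
  have hs0 : s 0 = t N ⟨0, hlt0⟩ := dif_pos hlt0
  have hsL : s (N - 1) = t N ⟨N - 1, hltL⟩ := dif_pos hltL
  have hstep : ∀ k ∈ Finset.range (N - 1),
      |s k - s (k + 1) - r * (D N / ((N : ℝ) - 1))| ≤
        max C 0 * |D N / ((N : ℝ) - 1)| * (θ ^ k + θ ^ (N - 2 - k)) := by
    intro k hk
    rw [Finset.mem_range] at hk
    have hk1 : k < N := by omega
    have hk2 : k + 1 < N := by omega
    have h1 : s k = t N ⟨k, hk1⟩ := dif_pos hk1
    have h2 : s (k + 1) = t N ⟨k + 1, hk2⟩ := dif_pos hk2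
    rw [h1, h2]
    calc |t N ⟨k, hk1⟩ - t N ⟨k + 1, hk2⟩ - r * (D N / ((N : ℝ) - 1))|
        ≤ C * |D N / ((N : ℝ) - 1)| * (θ ^ k + θ ^ (N - 2 - k)) := hbN ⟨k, hk1⟩ ⟨k + 1, hk2⟩ rfl
      _ ≤ max C 0 * |D N / ((N : ℝ) - 1)| * (θ ^ k + θ ^ (N - 2 - k)) := by
        apply mul_le_mul_of_nonneg_right
        · exact mul_le_mul_of_nonneg_right (le_max_left _ _) (abs_nonneg _)
        · positivity
  have htel : ∑ k ∈ Finset.range (N - 1), (s k - s (k + 1)) = s 0 - s (N - 1) :=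
    Finset.sum_range_sub' s (N - 1)
  -- geometric bound, uniform in N
  have hgeom1 : ∑ k ∈ Finset.range (N - 1), θ ^ k ≤ 1 / (1 - θ) := by
    rw [le_div_iff₀ h1θ, geom_sum_mul_neg]
    have : 0 ≤ θ ^ (N - 1) := pow_nonneg hθ0 _
    linarith
  have hrefl : ∑ k ∈ Finset.range (N - 1), θ ^ (N - 2 - k) =
      ∑ k ∈ Finset.range (N - 1), θ ^ k := by
    rw [← Finset.sum_range_reflect (fun k => θ ^ k) (N - 1)]
    refine Finset.sum_congr rfl fun k _ => ?_
    congr 1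
  have hgeom : ∑ k ∈ Finset.range (N - 1), (θ ^ k + θ ^ (N - 2 - k)) ≤ 2 / (1 - θ) := by
    rw [Finset.sum_add_distrib, hrefl]
    have h2 : (2 : ℝ) / (1 - θ) = 1 / (1 - θ) + 1 / (1 - θ) := by ring
    rw [h2]
    exact add_le_add hgeom1 hgeom1
  -- the telescoped estimate
  have hcard : ((Finset.range (N - 1)).card : ℝ) = (N : ℝ) - 1 := by
    rw [Finset.card_range, Nat.cast_sub (by omega : 1 ≤ N), Nat.cast_one]
  have hE : |t N ⟨0, hlt0⟩ - t N ⟨N - 1, hltL⟩ - ((N : ℝ) - 1) * (r * (D N / ((N : ℝ) - 1)))| ≤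
      max C 0 * |D N / ((N : ℝ) - 1)| * (2 / (1 - θ)) := by
    have hrepr : t N ⟨0, hlt0⟩ - t N ⟨N - 1, hltL⟩ - ((N : ℝ) - 1) * (r * (D N / ((N : ℝ) - 1))) =
        ∑ k ∈ Finset.range (N - 1), (s k - s (k + 1) - r * (D N / ((N : ℝ) - 1))) := by
      rw [Finset.sum_sub_distrib, htel, hs0, hsL, Finset.sum_const, nsmul_eq_mul, hcard]
    rw [hrepr]
    calc |∑ k ∈ Finset.range (N - 1), (s k - s (k + 1) - r * (D N / ((N : ℝ) - 1)))|
        ≤ ∑ k ∈ Finset.range (N - 1), |s k - s (k + 1) - r * (D N / ((N : ℝ) - 1))| :=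
          Finset.abs_sum_le_sum_abs _ _
      _ ≤ ∑ k ∈ Finset.range (N - 1),
            max C 0 * |D N / ((N : ℝ) - 1)| * (θ ^ k + θ ^ (N - 2 - k)) :=
          Finset.sum_le_sum hstep
      _ = max C 0 * |D N / ((N : ℝ) - 1)| *
            ∑ k ∈ Finset.range (N - 1), (θ ^ k + θ ^ (N - 2 - k)) := by
          rw [Finset.mul_sum]
      _ ≤ max C 0 * |D N / ((N : ℝ) - 1)| * (2 / (1 - θ)) := by
          apply mul_le_mul_of_nonneg_left hgeom
          exact mul_nonneg (le_max_right _ _) (abs_nonneg _)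
  -- contact rows: t(0) = 1/2 - g/γ, t(N-1) = g/γ - 1/2
  have ht0 : t N ⟨0, hlt0⟩ = 1 / 2 - D N / ((N : ℝ) - 1) / γ := by
    rw [← hc0]; field_simp; ring
  have htL : t N ⟨N - 1, hltL⟩ = D N / ((N : ℝ) - 1) / γ - 1 / 2 := by
    rw [← hcL]; field_simp; ring
  have hX : ((N : ℝ) - 1) / D N - 2 / γ - ((N : ℝ) - 1) * r =
      (t N ⟨0, hlt0⟩ - t N ⟨N - 1, hltL⟩ - ((N : ℝ) - 1) * (r * (D N / ((N : ℝ) - 1)))) /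
        (D N / ((N : ℝ) - 1)) := by
    rw [ht0, htL]
    field_simp
    ring
  rw [hX, abs_div, abs_of_pos hg, div_le_iff₀ hg]
  calc |t N ⟨0, hlt0⟩ - t N ⟨N - 1, hltL⟩ - ((N : ℝ) - 1) * (r * (D N / ((N : ℝ) - 1)))|
      ≤ max C 0 * |D N / ((N : ℝ) - 1)| * (2 / (1 - θ)) := hE
    _ = 2 * max C 0 / (1 - θ) * (D N / ((N : ℝ) - 1)) := by
      rw [abs_of_pos hg]; ring

/-- **Transport dichotomy forced by the crux.** Under `TwoModeBulk`, at every admissible parameter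
point, along any steady-state family and for every `T > 0`: EITHER Fourier's law with an `O(1)`
total-contact-resistance rate — `κ > 0` and `B` with `|(N-1)/D_N - (N-1)/κ| ≤ B` for all `N ≥ 2`
(hence `D_N → κ` with `|1/D_N - 1/κ| ≤ B/(N-1)`) — OR ballistic transport, `D_N ≥ c·(N-1)` for all
`N ≥ 2` with `c > 0` (the `r ≤ 0` branch of the ledger; the harmonic member realises it, support
`HarmonicTwoModeCalibration`). Both branches are `N`-uniform statements of the class blocked by
`FixedLengthNoConductivityControl`. [folklore] -/
theorem transportDichotomy_of_twoModeBulk (hTM : TwoModeBulk) {ω₂ lam β γ : ℝ} (hω : 0 < ω₂)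
    (hl : 0 < lam) (hβ : 0 < β) (hγ : 0 < γ)
    (huniq : ∀ (N : ℕ) (T_L T_R : ℝ), 0 < T_L → 0 < T_R → ∀ μ ν : Measure (PhaseSpace N),
      (pinnedChain ω₂ lam β γ).IsSteadyState N T_L T_R μ →
        (pinnedChain ω₂ lam β γ).IsSteadyState N T_L T_R ν → μ = ν)
    (μ : (N : ℕ) → ℝ → ℝ → Measure (PhaseSpace N))
    (hμ : ∀ (N : ℕ) (T_L T_R : ℝ), 0 < T_L → 0 < T_R →
      (pinnedChain ω₂ lam β γ).IsSteadyState N T_L T_R (μ N T_L T_R))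
    {T : ℝ} (hT : 0 < T) (D : ℕ → ℝ)
    (hD : ∀ N : ℕ, Tendsto
      (fun δ : ℝ => (pinnedChain ω₂ lam β γ).totalCurrent (μ N (T + δ / 2) (T - δ / 2)) / δ)
      (𝓝[≠] 0) (𝓝 (D N))) :
    (∃ κ B : ℝ, 0 < κ ∧ ∀ N : ℕ, 2 ≤ N → |((N : ℝ) - 1) / D N - ((N : ℝ) - 1) / κ| ≤ B) ∨
      (∃ c : ℝ, 0 < c ∧ ∀ N : ℕ, 2 ≤ N → c * ((N : ℝ) - 1) ≤ D N) := by
  obtain ⟨r, B, hL⟩ := boundedLedger_of_twoModeBulk hTM hω hl hβ hγ huniq μ hμ hT D hD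
  have hpos : ∀ N : ℕ, 2 ≤ N → 0 < D N :=
    PositiveConductance_holds ω₂ lam β γ hω hl hβ hγ huniq μ hμ T hT D hD
  rcases lt_or_ge 0 r with hr | hr
  · -- Fourier branch with rate: κ = 1/r, constant B + 2/γ
    refine Or.inl ⟨1 / r, B + 2 / γ, by positivity, fun N hN => ?_⟩
    have hrw : ((N : ℝ) - 1) / (1 / r) = ((N : ℝ) - 1) * r := by
      rw [div_div_eq_mul_div, div_one]
    rw [hrw]
    have h := hL N hN
    have hsplit : ((N : ℝ) - 1) / D N - ((N : ℝ) - 1) * r =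
        (((N : ℝ) - 1) / D N - 2 / γ - ((N : ℝ) - 1) * r) + 2 / γ := by ring
    rw [hsplit]
    calc |((N : ℝ) - 1) / D N - 2 / γ - ((N : ℝ) - 1) * r + 2 / γ|
        ≤ |((N : ℝ) - 1) / D N - 2 / γ - ((N : ℝ) - 1) * r| + |2 / γ| := abs_add_le _ _
      _ ≤ B + 2 / γ := add_le_add h (le_of_eq (abs_of_pos (div_pos two_pos hγ)))
  · -- ballistic branch: (N-1)/D_N ≤ K := B + 2/γ, K > 0, so D_N ≥ (N-1)/K
    have hK : ∀ N : ℕ, 2 ≤ N → ((N : ℝ) - 1) / D N ≤ B + 2 / γ := by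
      intro N hN
      have hN2 : (2 : ℝ) ≤ (N : ℝ) := by exact_mod_cast hN
      have h := (abs_le.mp (hL N hN)).2
      have hnr : ((N : ℝ) - 1) * r ≤ 0 :=
        mul_nonpos_of_nonneg_of_nonpos (by linarith) hr
      linarith
    have hKpos : 0 < B + 2 / γ := by
      have h2 := hK 2 le_rfl
      have hq : (0 : ℝ) < (((2 : ℕ) : ℝ) - 1) / D 2 := div_pos (by norm_num) (hpos 2 le_rfl)
      linarith
    refine Or.inr ⟨1 / (B + 2 / γ), by positivity, fun N hN => ?_⟩
    have hN2 : (2 : ℝ) ≤ (N : ℝ) := by exact_mod_cast hN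
    have hNpos : (0 : ℝ) < (N : ℝ) - 1 := by linarith
    have hDpos : 0 < D N := hpos N hN
    have h := hK N hN
    rw [div_le_iff₀ hDpos] at h
    rw [one_div, inv_mul_le_iff₀ hKpos]
    linarith [mul_comm (B + 2 / γ) (D N)]

/-- **Under the crux, Fourier's law self-improves to an `O(1/N)` rate.** `TwoModeBulk` and
`FouriersLaw` together give, along any steady-state family and for every `T > 0`, `κ > 0` and `B`
with `|(N-1)/D_N - (N-1)/κ| ≤ B` for all `N ≥ 2` — the ballistic branch of
`transportDichotomy_of_twoModeBulk` contradicts `hasBoundedResponse_of_fouriersLawFor`. The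
Statement alone asserts only `D_N → κ(T)` with no rate: this is the precise sense in which the crux
carries `N`-uniform information beyond the summit. [folklore] -/
theorem rateFourier_of_twoModeBulk_of_fouriersLaw (hTM : TwoModeBulk) (hF : _root_.FouriersLaw)
    {ω₂ lam β γ : ℝ} (hω : 0 < ω₂) (hl : 0 < lam) (hβ : 0 < β) (hγ : 0 < γ)
    (μ : (N : ℕ) → ℝ → ℝ → Measure (PhaseSpace N))
    (hμ : ∀ (N : ℕ) (T_L T_R : ℝ), 0 < T_L → 0 < T_R →
      (pinnedChain ω₂ lam β γ).IsSteadyState N T_L T_R (μ N T_L T_R))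
    {T : ℝ} (hT : 0 < T) (D : ℕ → ℝ)
    (hD : ∀ N : ℕ, Tendsto
      (fun δ : ℝ => (pinnedChain ω₂ lam β γ).totalCurrent (μ N (T + δ / 2) (T - δ / 2)) / δ)
      (𝓝[≠] 0) (𝓝 (D N))) :
    ∃ κ B : ℝ, 0 < κ ∧ ∀ N : ℕ, 2 ≤ N → |((N : ℝ) - 1) / D N - ((N : ℝ) - 1) / κ| ≤ B := by
  have huniq := NessUnique_holds ω₂ lam β γ hω hl hβ hγ
  rcases transportDichotomy_of_twoModeBulk hTM hω hl hβ hγ huniq μ hμ hT D hD with h | ⟨c, hc, hball⟩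
  · exact h
  · exfalso
    obtain ⟨B, hB⟩ := hasBoundedResponse_of_fouriersLawFor (hF ω₂ lam β γ hω hl hβ hγ) μ hμ T hT D hD
    have h2 : ∀ᶠ N : ℕ in atTop, B + 1 ≤ c * ((N : ℝ) - 1) :=
      (tendsto_natCast_sub_one_atTop.const_mul_atTop hc).eventually_ge_atTop (B + 1)
    obtain ⟨N, hN, hN2⟩ := (h2.and (eventually_ge_atTop 2)).exists
    have hle : D N ≤ B := (le_abs_self _).trans (hB ⟨N, rfl⟩)
    have hge : c * ((N : ℝ) - 1) ≤ D N := hball N hN2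
    linarith

end TwoModeBulkPlacement

/-- **Registered stub `twoModeBulk_summitPlacement` (item stmt-AtomisticToContinuum-12111): the
summit placement of the crux in one statement** — (1) `TwoModeBulk → (FouriersLaw ↔ NonBallistic)`;
(2) `TwoModeBulk → (FouriersLaw ↔ ∀ admissible parameters, HasBoundedResponse (pinnedChain …))`
(the catalogued barrier predicate of `FixedLengthNoConductivityControl`); (3) under `TwoModeBulk`,
along every steady-state family: the transport dichotomy (Fourier with an `O(1)` ledger rate, or
ballistic) and the self-improvement `FouriersLaw → rate form`. [folklore] -/
theorem twoModeBulk_summitPlacement : (Summit.AtomisticToContinuum.FouriersLaw.Theses.PuiseuxTransferLedger.TwoModeBulk → (_root_.FouriersLaw ↔ Summit.AtomisticToContinuum.FouriersLaw.Theses.PuiseuxTransferLedger.NonBallistic)) ∧ (Summit.AtomisticToContinuum.FouriersLaw.Theses.PuiseuxTransferLedger.TwoModeBulk → (_root_.FouriersLaw ↔ ∀ ω₂ lam β γ : ℝ, 0 < ω₂ → 0 < lam → 0 < β → 0 < γ → Literature.Barriers.AtomisticToContinuum.HasBoundedResponse (Literature.MathematicalPhysics.KineticTheory.HeatConduction.pinnedChain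 ω₂ lam β γ))) ∧ (Summit.AtomisticToContinuum.FouriersLaw.Theses.PuiseuxTransferLedger.TwoModeBulk → ∀ ω₂ lam β γ : ℝ, 0 < ω₂ → 0 < lam → 0 < β → 0 < γ → ∀ μ : (N : ℕ) → ℝ → ℝ → MeasureTheory.Measure (Literature.MathematicalPhysics.KineticTheory.HeatConduction.PhaseSpace N), (∀ (N : ℕ) (T_L T_R : ℝ), 0 < T_L → 0 < T_R → (Literature.MathematicalPhysics.KineticTheory.HeatConduction.pinnedChain ω₂ lam β γ).IsSteadyState N T_L T_R (μ N T_L T_R)) → ∀ T : ℝ, 0 < T → ∀ D : ℕ → ℝ, (∀ N : ℕ, Filter.Tendsto (fun δ : ℝ => (Literature.MathematicalPhysics.KineticTheory.HeatConduction.pinnedChain ω₂ lam β γ).totalCurrent (μ N (T + δ / 2) (T - δ / 2)) / δ) (nhdsWithin 0 {(0 : ℝ)}ᶜ) (nhds (D N))) → ((∃ κ B : ℝ, 0 < κ ∧ ∀ N : ℕ, 2 ≤ N → |((N : ℝ) - 1) / D N - ((N : ℝ) - 1) / κ| ≤ B) ∨ (∃ c : ℝ, 0 < c ∧ ∀ N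 : ℕ, 2 ≤ N → c * ((N : ℝ) - 1) ≤ D N)) ∧ (_root_.FouriersLaw → ∃ κ B : ℝ, 0 < κ ∧ ∀ N : ℕ, 2 ≤ N → |((N : ℝ) - 1) / D N - ((N : ℝ) - 1) / κ| ≤ B)) :=
  ⟨TwoModeBulkPlacement.fouriersLaw_iff_nonBallistic_of_twoModeBulk,
    TwoModeBulkPlacement.fouriersLaw_iff_forall_hasBoundedResponse_of_twoModeBulk,
    fun hTM ω₂ lam β γ hω hl hβ hγ μ hμ _ hT D hD =>
      ⟨TwoModeBulkPlacement.transportDichotomy_of_twoModeBulk hTM hω hl hβ hγ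
          (Summit.AtomisticToContinuum.FouriersLaw.Theses.PuiseuxTransferLedger.NessUnique_holds ω₂ lam β γ
            hω hl hβ hγ) μ hμ hT D hD,
        fun hF => TwoModeBulkPlacement.rateFourier_of_twoModeBulk_of_fouriersLaw hTM hF hω hl hβ hγ
          μ hμ hT D hD⟩⟩

end Summit.AtomisticToContinuum.FouriersLaw.Theorems
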